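import Literature.Computability.FineGrained.CompactionMachine
import HarnessLib

/-!
# Impagliazzo–Paturi, Lemma 2 — discharges of the machine facts of `IPLemma2Assembly.lean`

Family `fine-grained` (trunk T-CPLX-FINE). `IPLemma2Assembly.lean` assembles Impagliazzo–Paturi,
*On the complexity of k-SAT*, JCSS 62 (2001), Lemma 2 (p. 373; conference version: Proc. 14th
IEEE CCC (1999), Theorem 2, p. 4: "Moreover, F̂ can be computed from F in time
O(poly(n) 2^{2εn})") from named *machine* facts. This sibling file records their discharges
under the facts' own fully qualified names (`<fact>_holds` next to `<fact>` in the namespace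
`Literature.Computability.FineGrained`), so that users of `(h : <fact>)` are fed `<fact>_holds`:

* `kCNF_compact_computable_holds` — the compaction machine of `CompactionMachine.lean`
  (`Compaction.kCNF_compact_computable_holds`, proved there in the sub-namespace `Compaction`).

The second machine fact, `ipRename_reduceList_computable` (the renaming machine proper), is
reduced by `IPLemma2MachineLift.lean` (`ipRename_reduceList_computable_of_single`) to a
one-formula machine, under construction in `IPRename*.lean`; its discharge is to be appended
here when that machine lands.

## References

* R. Impagliazzo, R. Paturi, *On the complexity of k-SAT*, J. Comput. System Sci. 62 (2001)
  367–375, doi:10.1006/jcss.2000.1727, Lemma 2 (p. 373) and its proof sketch (p. 374).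
* R. Impagliazzo, R. Paturi, *Complexity of k-SAT*, Proc. 14th Annual IEEE Conference on
  Computational Complexity (1999) 237–240, doi:10.1109/ccc.1999.766282, Theorem 2 (p. 4).
* S. Arora, B. Barak, *Computational Complexity: A Modern Approach*, CUP 2009, §1.3
  (multi-tape machine constructions).
-/

namespace Literature.Computability.FineGrained

/-- **Compaction is polynomial-time** (discharge of `kCNF_compact_computable` under its own
name): some multi-stack machine computes `KCNF.compact` from `KCNF.encode` to `KCNF.encode` in
time `c (L + 1)^c` (`c = 80`, `CompactionMachine.lean`).
[cite: AroraBarak2009, §1.3 (multi-tape machine constructions)] -/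
theorem kCNF_compact_computable_holds : kCNF_compact_computable :=
  Compaction.kCNF_compact_computable_holds

end Literature.Computability.FineGrained
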